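import Literature.NumberTheory.Transcendental.ExpGridAuxiliary
import Literature.NumberTheory.Transcendental.BakerLogarithms
import Literature.NumberTheory.Transcendental.IntegerTaylor
import HarnessLib

/-!
# Laurent's Théorème 3 iii) (Diaz 1989 / Philippon 1986, Thm 2.12 (i)) — the construction

Topic `Literature/NumberTheory/Transcendental`. First step (proofs and definitions with bodies,
no named fact) of the conditional proof of the large range of the named fact
`Literature.NumberTheory.Transcendental.Diaz1989_main_iii` (`DiazMain.lean`; M. Laurent,
Astérisque 198–200 (1991), §3.1, Théorème 3 iii), p. 213: `t₃ = trdeg ℚ(xᵢ, yⱼ, e^{xᵢyⱼ}) ≥ mn/(m+n)`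
under fixed-exponent measures of linear independence; = Philippon 1986, Publ. IHÉS 64, Thm 2.12 (i)
under the Technical Hypothesis; Diaz 1989, p. 2, "permet aussi de retrouver") from Philippon's
criterion `Philippon1986_mainCriterion` and the zero estimate `Philippon1986_GaGm`. This is
Gel'fond's method WITH DERIVATIVES on `𝔾ₐ × 𝔾ₘⁿ`, run — as Diaz runs the derivative-free case
(`DiazConstruction.lean`, J. Number Theory 31 (1989), §II-2) — with coefficients in `ℤ[θ]`:

Setting. `y₁, …, y_n` are the FREQUENCIES and `x₁, …, x_m` the POINTS (this is forced by the
shape of Laurent's hypotheses: the `xᵢ` carry the linear measure, which is what the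
interpolation at the points `l·x` costs; the `yⱼ` carry the exponent `η₃`). Letters
`Var n m = Fin n ⊕ (Fin m ⊕ Fin n × Fin m)` of `ExpGridAuxiliary.lean` stand for `y_i`, `x_j`,
`w_{ij} = e^{y_ix_j}`; the point is `θ = ExpGrid.pt y x`. The auxiliary function is
`F(z) = ∑_{a<D, μ∈[0,L)ⁿ} P_{aμ}(θ) z^a e^{(μ·y)z}` with unknown `P_{aμ} ∈ ℤ[Var]` of degree `< b`
in each letter (`Pam`), and `F^{(t)}(l·x) = Q_{l,t}(θ)` for the explicit
`Q_{l,t} = ∑ P_{aμ} V_{t,l,a,μ} ∈ ℤ[Var]` (`Q`, `aeval_pt_Q`; `V = ExpGrid.Vsym`, Baker's value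
polynomials). Contents (everything PROVED):

* `aeval_Q_eq_iteratedDeriv`, `aeval_Qj_eq_iteratedDeriv`, `aeval_Vsym_eq` — at an ARBITRARY point
  `θ'` (as needed on the ball of the criterion), `Q_{l,t}(θ')` is the `t`-th derivative at `τ = 0`
  of `τ ↦ ∑ P_{aμ}(θ') E_{μ,l}(θ') (Y_l(θ') + τ)^a e^{W_μ(θ')τ}`, i.e. of the restriction of
  `∑ P_{aμ}(θ') X₀^a W^μ` to a translate of the one-parameter subgroup `τ ↦ (τ, e^{θ'(y)τ})` of
  `𝔾ₐ × 𝔾ₘⁿ` through the point `(Y_l(θ'), (∏_j θ'(w_{ij})^{l_j})_i)` — the form consumed by the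
  zero lemma with multiplicities `DiazZLM.zeroLemmaMult_of_GaGm'` (`DiazZeroLemmaMult.lean`).
* `exists_coeffs` — Siegel's step (Baker 1975, Ch. 2, Lemma 1, `Baker1975.lemma1`): under
  (𝒞1) `2 M^m S (b+Δ)^{#Var} ≤ D Lⁿ b^{#Var}`, `Δ = S + D + nmLM`, unknowns `p ≠ 0` with
  `|p| ≤ #Unk·(D+nL)^S(mM+1)^D` and `Q_{l,t} = 0` IDENTICALLY for `l ∈ [0,M)^m`, `t < S`
  (`coeff_Q`, `lt_of_mem_support_Q`, `abs_mat_le`, `card_Unk`, `card_EqIdx`).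
* Diaz's device of the minimal Taylor index (§II-3-1, via `IntegerTaylor.lean`): `Pj`, `Qj`,
  `IsMinIdx`, `exists_isMinIdx`, `degree_le_of_isMinIdx`, and the key identity
  `aeval_Qj_eq_zero_of_isMinIdx`: `Q_{l,t} = 0` and `j` minimal at `θ'` give `Q_{l,t,j}(θ') = 0`
  EXACTLY.
* Sizes: `totalDegree_Pam_le`, `totalDegree_Pj_le`, `l1_Pam_le`, `l1_Pj_le`, `totalDegree_Qj_le`,
  `l1_Qj_le`.

## References

* M. Laurent, *Sur quelques résultats récents de transcendance*, Astérisque 198–200 (1991),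
  209–230, §3.1, Théorème 3 iii), p. 213. [Laurent1991]
* G. Diaz, *Grands degrés de transcendance pour des familles d'exponentielles*, J. Number Theory
  31 (1989), 1–23, §II-2 (construction), §II-3-1 (the `P_{dλj}`), pp. 4–9. [Diaz1989]
* P. Philippon, *Critères pour l'indépendance algébrique*, Publ. Math. IHÉS 64 (1986), 5–52,
  Thm 2.12 (i), p. 40. [Philippon1986Criteres]
* A. Baker, *Transcendental Number Theory* (1975), Ch. 2, Lemma 1; Ch. 12 §5 (value polynomials,
  as in `ExpGridAuxiliary.lean`). [BakerTNT1975]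
-/

noncomputable section

open MvPolynomial Finset Finsupp Complex
open scoped Polynomial
open Literature.NumberTheory.Transcendental.ExpGrid
open Literature.NumberTheory.Transcendental.Chudnovsky (wnorm wnorm_nonneg wnorm_mul_le
  wnorm_sum_le le_wnorm l1)
open Literature.NumberTheory.Transcendental.Taylor

namespace Literature.NumberTheory.Transcendental

namespace DiazMainIII

/-! ### Indices -/

/-- The indices `(a, μ)` of the auxiliary function `F(z) = ∑ p_{aμ} z^a e^{(μ·y)z}`:
`0 ≤ a < D`, `μ ∈ [0, L)ⁿ`. [folklore] -/
abbrev AM (n D L : ℕ) : Type := Fin D × (Fin n → Fin L)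

/-- Exponents of the monomials allowed in the coefficient polynomials `P_{aμ} ∈ ℤ[Var]`: a
uniform box, degree `< b` in each letter. [folklore] -/
abbrev ExpIdx (n m b : ℕ) : Type := Var n m → Fin b

/-- The unknowns of Siegel's system: all the integer coefficients of all `P_{aμ}`. [folklore] -/
abbrev Unk (n m D L b : ℕ) : Type := AM n D L × ExpIdx n m b

variable {n m D L M S b : ℕ}

/-- The exponent vector of an `ExpIdx`. [folklore] -/
def toExp (ε : ExpIdx n m b) : Var n m →₀ ℕ := equivFunOnFinite.symm fun v => (ε v : ℕ)

/-- `toExp` pointwise. [folklore] -/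
@[simp] theorem toExp_apply (ε : ExpIdx n m b) (v : Var n m) : toExp ε v = ε v := rfl

/-- `toExp` is injective. [folklore] -/
theorem toExp_injective : Function.Injective (toExp : ExpIdx n m b → Var n m →₀ ℕ) := by
  intro ε ε' h
  funext v
  exact Fin.ext (by simpa using congrArg (fun f => f v) h)

/-- A frequency multi-index as natural numbers. [folklore] -/
def natOf {p K : ℕ} (μ : Fin p → Fin K) : Fin p → ℕ := fun i => (μ i : ℕ)

/-- `natOf μ i < K`. [folklore] -/
theorem natOf_lt {p K : ℕ} (μ : Fin p → Fin K) (i : Fin p) : natOf μ i < K := (μ i).isLt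

/-! ### The coefficient polynomials `P_{aμ}` and the derived values `Q_{l,t}` -/

/-- `P_{aμ}(Var) = ∑_ε p_{(aμ),ε} Var^ε ∈ ℤ[Var]`, the unknown coefficient polynomial of
`z^a e^{(μ·y)z}`. [folklore] -/
def Pam (p : Unk n m D L b → ℤ) (am : AM n D L) : MvPolynomial (Var n m) ℤ :=
  ∑ ε : ExpIdx n m b, monomial (toExp ε) (p (am, ε))

/-- The coefficient of `Var^ε` in `P_{aμ}` is the unknown `p_{(aμ),ε}`. [folklore] -/
theorem coeff_toExp_Pam (p : Unk n m D L b → ℤ) (am : AM n D L) (ε : ExpIdx n m b) :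
    coeff (toExp ε) (Pam p am) = p (am, ε) := by
  unfold Pam
  rw [MvPolynomial.coeff_sum, Finset.sum_eq_single ε]
  · rw [coeff_monomial, if_pos rfl]
  · intro ε' _ hne
    rw [coeff_monomial, if_neg fun h => hne (toExp_injective h)]
  · intro h
    exact absurd (Finset.mem_univ ε) h

/-- If all `P_{aμ}` vanish then all unknowns vanish. [folklore] -/
theorem eq_zero_of_Pam_eq_zero {p : Unk n m D L b → ℤ} (h : ∀ am, Pam p am = 0) : p = 0 := by
  funext ⟨am, ε⟩
  have := coeff_toExp_Pam p am ε
  rw [h am, MvPolynomial.coeff_zero] at this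
  exact this.symm

/-- The monomials of `P_{aμ}` lie in the box: every exponent is `< b`. [folklore] -/
theorem lt_of_mem_support_Pam (p : Unk n m D L b → ℤ) (am : AM n D L) {β : Var n m →₀ ℕ}
    (hβ : β ∈ (Pam p am).support) (v : Var n m) : β v < b := by
  rw [MvPolynomial.mem_support_iff] at hβ
  unfold Pam at hβ
  rw [MvPolynomial.coeff_sum] at hβ
  obtain ⟨ε, _, hε⟩ := Finset.exists_ne_zero_of_sum_ne_zero hβ
  rw [MvPolynomial.coeff_monomial] at hε
  have : toExp ε = β := by
    by_contra h
    exact hε (if_neg h)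
  rw [← this, toExp_apply]
  exact (ε v).isLt

/-- **The derived values** `Q_{l,t} = ∑_{a,μ} P_{aμ} · V_{t,l,a,μ} ∈ ℤ[Var]`: at the point
`(y, x, e^{y x})` this is `F^{(t)}(l·x)` for `F(z) = ∑ P_{aμ}(θ) z^a e^{(μ·y)z}` (`aeval_pt_Q`).
[folklore] -/
def Q (p : Unk n m D L b → ℤ) (l : Fin m → ℕ) (t : ℕ) : MvPolynomial (Var n m) ℤ :=
  ∑ am : AM n D L, Pam p am * Vsym t l (am.1 : ℕ) (natOf am.2)

/-! ### Evaluation: the auxiliary function and its derivatives -/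

/-- **At the true point `θ = (y, x, e^{yx})`**: `Q_{l,t}(θ) = F^{(t)}(l·x)` where
`F = Φ_y` is the auxiliary function with coefficients `P_{aμ}(θ)` (`ExpGrid.Phi`).
[folklore] -/
theorem aeval_pt_Q (y : Fin n → ℂ) (x : Fin m → ℂ) (p : Unk n m D L b → ℤ) (l : Fin m → ℕ)
    (t : ℕ) :
    aeval (pt y x) (Q p l t) =
      iteratedDeriv t (Phi y fun am : AM n D L => aeval (pt y x) (Pam p am)) (ypt x l) := by
  rw [iteratedDeriv_Phi_ypt]
  unfold Q
  rw [map_sum]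
  refine Finset.sum_congr rfl fun am _ => ?_
  rw [map_mul]
  rfl

/-- The one-variable function whose `t`-th derivative at `0` is `V_{t,l,a,μ}(θ')` at an ARBITRARY
point `θ'`: `τ ↦ (Y_l(θ') + τ)^a e^{W_μ(θ') τ}`. [folklore] -/
theorem aeval_eval_Qsym (θ' : Var n m → ℂ) (t : ℕ) (l : Fin m → ℕ) (a : ℕ) (μ : Fin n → ℕ) :
    aeval θ' ((Qsym m t a μ).eval (Ysym n l)) =
      iteratedDeriv t (fun τ : ℂ => (aeval θ' (Ysym n l) + τ) ^ a *
        cexp (aeval θ' (Wsym m μ) * τ)) 0 := by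
  set w' : ℂ := aeval θ' (Wsym m μ) with hw'
  set y' : ℂ := aeval θ' (Ysym n l) with hy'
  -- left-hand side: `((step w')^t X^a)(y')`
  have hL : aeval θ' ((Qsym m t a μ).eval (Ysym n l)) =
      (((step w')^[t]) ((Polynomial.X : ℂ[X]) ^ a)).eval y' := by
    set φ : MvPolynomial (Var n m) ℤ →+* ℂ := (MvPolynomial.aeval θ').toRingHom with hφ
    change φ ((Qsym m t a μ).eval₂ (RingHom.id _) (Ysym n l)) = _
    rw [Polynomial.hom_eval₂, RingHom.comp_id, ← Polynomial.eval_map, Qsym, iterate_step_map,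
      Polynomial.map_pow, Polynomial.map_X]
    rfl
  -- right-hand side: shift to `y'` and use `iteratedDeriv_expMono`
  have hfun : (fun τ : ℂ => (y' + τ) ^ a * cexp (w' * τ)) =
      fun τ => cexp (-(w' * y')) * expMono w' ((Polynomial.X : ℂ[X]) ^ a) (τ + y') := by
    funext τ
    simp only [expMono, Polynomial.eval_pow, Polynomial.eval_X]
    rw [show w' * (τ + y') = w' * τ + w' * y' by ring, Complex.exp_add, add_comm τ y']
    have : cexp (-(w' * y')) * cexp (w' * y') = 1 := by
      rw [← Complex.exp_add]; simp
    calc (y' + τ) ^ a * cexp (w' * τ)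
        = (y' + τ) ^ a * cexp (w' * τ) * (cexp (-(w' * y')) * cexp (w' * y')) := by
          rw [this, mul_one]
      _ = _ := by ring
  have hcd : ContDiffAt ℂ t (fun τ : ℂ => expMono w' ((Polynomial.X : ℂ[X]) ^ a) (τ + y')) 0 := by
    exact ((contDiff_expMono w' _).comp (contDiff_id.add contDiff_const)).contDiffAt
  rw [hL, hfun, iteratedDeriv_const_mul _ hcd]
  · have hshift := iteratedDeriv_comp_add_const t (expMono w' ((Polynomial.X : ℂ[X]) ^ a)) y'
    rw [hshift]
    simp only [zero_add]
    rw [iteratedDeriv_expMono]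
    simp only [expMono]
    rw [← mul_assoc, mul_comm (cexp _), mul_assoc, ← Complex.exp_add]
    simp

/-- **`V_{t,l,a,μ}` at an arbitrary point `θ'`**:
`V(θ') = (d/dτ)^t [(Y_l(θ') + τ)^a e^{W_μ(θ')τ}]|_{τ=0} · E_{μ,l}(θ')`. [folklore] -/
theorem aeval_Vsym_eq (θ' : Var n m → ℂ) (t : ℕ) (l : Fin m → ℕ) (a : ℕ) (μ : Fin n → ℕ) :
    aeval θ' (Vsym t l a μ) =
      iteratedDeriv t (fun τ : ℂ => (aeval θ' (Ysym n l) + τ) ^ a *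
        cexp (aeval θ' (Wsym m μ) * τ)) 0 * aeval θ' (Esym μ l) := by
  rw [Vsym, map_mul, aeval_eval_Qsym]

/-- The summand of `Q_{l,t}(θ')` as a derivative, with the factor `E_{μ,l}(θ')` inside.
[folklore] -/
theorem aeval_Vsym_eq' (θ' : Var n m → ℂ) (t : ℕ) (l : Fin m → ℕ) (a : ℕ) (μ : Fin n → ℕ)
    (c : ℂ) :
    c * aeval θ' (Vsym t l a μ) =
      iteratedDeriv t (fun τ : ℂ => c * aeval θ' (Esym μ l) *
        ((aeval θ' (Ysym n l) + τ) ^ a * cexp (aeval θ' (Wsym m μ) * τ))) 0 := by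
  rw [aeval_Vsym_eq, iteratedDeriv_const_mul _ (by fun_prop)]
  ring

/-- **`Q_{l,t}` at an arbitrary point `θ'` is a `t`-th derivative at `0`** of the one-variable
function `τ ↦ ∑_{a,μ} P_{aμ}(θ') E_{μ,l}(θ') (Y_l(θ') + τ)^a e^{W_μ(θ')τ}` — the restriction of the
polynomial `∑ P_{aμ}(θ') X₀^a W^μ` to the translate by the point `(Y_l(θ'), (∏_j θ'(w_{ij})^{l_j})_i)`
of the one-parameter subgroup `τ ↦ (τ, e^{θ'(y_i)τ})` of `𝔾ₐ × 𝔾ₘⁿ`. [folklore] -/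
theorem aeval_Q_eq_iteratedDeriv (θ' : Var n m → ℂ) (p : Unk n m D L b → ℤ) (l : Fin m → ℕ)
    (t : ℕ) :
    aeval θ' (Q p l t) =
      iteratedDeriv t (fun τ : ℂ => ∑ am : AM n D L,
        aeval θ' (Pam p am) * aeval θ' (Esym (natOf am.2) l) *
          ((aeval θ' (Ysym n l) + τ) ^ (am.1 : ℕ) * cexp (aeval θ' (Wsym m (natOf am.2)) * τ))) 0 := by
  unfold Q
  rw [map_sum, iteratedDeriv_fun_sum fun am _ => by fun_prop]
  refine Finset.sum_congr rfl fun am _ => ?_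
  rw [map_mul, aeval_Vsym_eq']

/-! ### The linear system: coefficients of `Q_{l,t}` -/

/-- The coefficients of `Q_{l,t}` are linear forms in the unknowns with integer coefficients.
[folklore] -/
theorem coeff_Q (p : Unk n m D L b → ℤ) (l : Fin m → ℕ) (t : ℕ) (e : Var n m →₀ ℕ) :
    coeff e (Q p l t) =
      ∑ w : Unk n m D L b, p w * coeff e (monomial (toExp w.2) 1 * Vsym t l (w.1.1 : ℕ) (natOf w.1.2)) := by
  unfold Q Pam
  rw [MvPolynomial.coeff_sum, Fintype.sum_prod_type (fun w : Unk n m D L b =>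
    p w * coeff e (monomial (toExp w.2) 1 * Vsym t l (w.1.1 : ℕ) (natOf w.1.2)))]
  refine Finset.sum_congr rfl fun am _ => ?_
  rw [Finset.sum_mul, MvPolynomial.coeff_sum]
  refine Finset.sum_congr rfl fun ε _ => ?_
  rw [show monomial (toExp ε) (p (am, ε)) = C (p (am, ε)) * monomial (toExp ε) 1 by
    rw [C_mul_monomial, mul_one], mul_assoc, coeff_C_mul]

/-- **Support of `Q_{l,t}`**: for `t < S`, `lⱼ < M` (and `μᵢ < L`, `a < D`), every exponent of a
monomial of `Q_{l,t}` is `< b + Δ` with `Δ = S + D + nmLM` (the monomials of `P_{aμ}` have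
exponents `< b`, those of `V_{t,l,a,μ}` have total degree `≤ t + a + ∑ μᵢlⱼ < Δ`). [folklore] -/
theorem lt_of_mem_support_Q (p : Unk n m D L b → ℤ) {l : Fin m → ℕ} (hl : ∀ j, l j < M) {t : ℕ}
    (ht : t < S) {e : Var n m →₀ ℕ} (he : e ∈ (Q p l t).support) (v : Var n m) :
    e v < b + (S + D + n * m * L * M) := by
  unfold Q at he
  obtain ⟨am, _, ham⟩ := Finset.mem_biUnion.mp (support_sum he)
  obtain ⟨β, hβ, γ, hγ, rfl⟩ := Finset.mem_add.mp (support_mul _ _ ham)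
  have h1 : β v < b := lt_of_mem_support_Pam p am hβ v
  have h2 : γ v ≤ t + (am.1 : ℕ) + ∑ i, ∑ j, natOf am.2 i * l j := by
    refine le_trans ?_ (degree_le_of_mem_support_Vsym t l (am.1 : ℕ) (natOf am.2) hγ)
    by_cases hv : v ∈ γ.support
    · exact Finset.single_le_sum (fun _ _ => Nat.zero_le _) hv
    · rw [Finsupp.notMem_support_iff.mp hv]
      exact Nat.zero_le _
  have h3 : ∑ i, ∑ j, natOf am.2 i * l j ≤ n * m * L * M := by
    calc ∑ i, ∑ j, natOf am.2 i * l j ≤ ∑ _i : Fin n, ∑ _j : Fin m, L * M :=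
          Finset.sum_le_sum fun i _ => Finset.sum_le_sum fun j _ =>
            Nat.mul_le_mul (natOf_lt am.2 i).le (hl j).le
      _ = n * m * L * M := by simp [mul_comm, mul_left_comm]
  have h4 : (am.1 : ℕ) < D := am.1.isLt
  rw [Finsupp.add_apply]
  omega

/-! ### Siegel's step -/

/-- Exponents bounding the monomials of `Q_{l,t}`. [folklore] -/
abbrev ExpIdxE (n m b Δ : ℕ) : Type := Var n m → Fin (b + Δ)

/-- The equations of Siegel's system: a point `l ∈ [0,M)^m`, an order `t < S` and a monomial.
[folklore] -/
abbrev EqIdx (n m D L M S b : ℕ) : Type :=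
  (Fin m → Fin M) × Fin S × ExpIdxE n m b (S + D + n * m * L * M)

/-- The exponent vector of an `ExpIdxE`. [folklore] -/
def toExpE {Δ : ℕ} (e : ExpIdxE n m b Δ) : Var n m →₀ ℕ := equivFunOnFinite.symm fun v => (e v : ℕ)

/-- `toExpE` pointwise. [folklore] -/
@[simp] theorem toExpE_apply {Δ : ℕ} (e : ExpIdxE n m b Δ) (v : Var n m) : toExpE e v = e v := rfl

/-- The matrix of Siegel's system: the coefficient of `Var^e` in `Var^ε V_{t,l,a,μ}`. [folklore] -/
def mat (i : EqIdx n m D L M S b) (w : Unk n m D L b) : ℤ :=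
  coeff (toExpE i.2.2) (monomial (toExp w.2) 1 * Vsym (i.2.1 : ℕ) (natOf i.1) (w.1.1 : ℕ) (natOf w.1.2))

/-- **Entries of Siegel's system**: `|entry| ≤ (D + nL)^S (mM + 1)^D` (from `ExpGrid.l1_Vsym_le`).
[folklore] -/
theorem abs_mat_le (i : EqIdx n m D L M S b) (w : Unk n m D L b) :
    |(mat i w : ℝ)| ≤ ((D : ℝ) + n * L) ^ S * ((m : ℝ) * M + 1) ^ D := by
  have hV := l1_Vsym_le (i.2.1 : ℕ) (m := M) (L₁ := L) (natOf i.1) (natOf_lt i.1) (w.1.1 : ℕ)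
    (natOf w.1.2) (natOf_lt w.1.2)
  unfold mat
  calc |((coeff (toExpE i.2.2) (monomial (toExp w.2) 1 *
        Vsym (i.2.1 : ℕ) (natOf i.1) (w.1.1 : ℕ) (natOf w.1.2)) : ℤ) : ℝ)|
      = normRingSeminorm ℤ (coeff (toExpE i.2.2) (monomial (toExp w.2) 1 *
        Vsym (i.2.1 : ℕ) (natOf i.1) (w.1.1 : ℕ) (natOf w.1.2))) := by
        rw [Chudnovsky.normRingSeminorm_int_apply]
    _ ≤ l1 (monomial (toExp w.2) (1 : ℤ) * Vsym (i.2.1 : ℕ) (natOf i.1) (w.1.1 : ℕ) (natOf w.1.2)) :=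
        le_wnorm _ _ _
    _ ≤ l1 (monomial (toExp w.2) (1 : ℤ)) * l1 (Vsym (i.2.1 : ℕ) (natOf i.1) (w.1.1 : ℕ) (natOf w.1.2)) :=
        wnorm_mul_le _ _ _
    _ ≤ 1 * ((((w.1.1 : ℕ) : ℝ) + n * L) ^ (i.2.1 : ℕ) * ((m : ℝ) * M + 1) ^ (w.1.1 : ℕ)) := by
        refine mul_le_mul ?_ hV (wnorm_nonneg _ _) zero_le_one
        rw [l1, Chudnovsky.wnorm_monomial, Chudnovsky.normRingSeminorm_int_one]
    _ ≤ 1 * (((D : ℝ) + n * L) ^ S * ((m : ℝ) * M + 1) ^ D) := by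
        have ha : (((w.1.1 : ℕ) : ℝ) + n * L) ≤ (D : ℝ) + n * L := by
          have : (((w.1.1 : ℕ) : ℝ)) ≤ D := by exact_mod_cast w.1.1.isLt.le
          linarith
        have h1 : (1 : ℝ) ≤ (D : ℝ) + n * L := by
          have : (1 : ℝ) ≤ D := by
            have := w.1.1.isLt
            exact_mod_cast (show 1 ≤ D by omega)
          have : (0 : ℝ) ≤ n * L := by positivity
          linarith
        have h2 : (1 : ℝ) ≤ (m : ℝ) * M + 1 := le_add_of_nonneg_left (by positivity)
        refine mul_le_mul_of_nonneg_left ?_ zero_le_one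
        calc ((((w.1.1 : ℕ) : ℝ) + n * L) ^ (i.2.1 : ℕ) * ((m : ℝ) * M + 1) ^ (w.1.1 : ℕ))
            ≤ ((D : ℝ) + n * L) ^ (i.2.1 : ℕ) * ((m : ℝ) * M + 1) ^ (w.1.1 : ℕ) := by
              gcongr
          _ ≤ ((D : ℝ) + n * L) ^ S * ((m : ℝ) * M + 1) ^ D := by
              gcongr
              · exact i.2.1.isLt.le
              · exact w.1.1.isLt.le
    _ = _ := one_mul _

/-- `#Unk = D Lⁿ b^{#Var}`. [folklore] -/
theorem card_Unk : Fintype.card (Unk n m D L b) = D * L ^ n * b ^ Fintype.card (Var n m) := by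
  simp only [Fintype.card_prod, Fintype.card_fin, Fintype.card_fun]

/-- `#EqIdx = M^m S (b + Δ)^{#Var}`. [folklore] -/
theorem card_EqIdx : Fintype.card (EqIdx n m D L M S b) =
    M ^ m * (S * (b + (S + D + n * m * L * M)) ^ Fintype.card (Var n m)) := by
  simp only [Fintype.card_prod, Fintype.card_fin, Fintype.card_fun]

set_option maxHeartbeats 800000 in
/-- **Siegel's step.** If `D, L ≥ 1`, `M, S ≥ 1` and
(𝒞1) `2 M^m S (b + Δ)^{#Var} ≤ D Lⁿ b^{#Var}` (`Δ = S + D + nmLM`), there are integers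
`p_{(aμ),ε}`, not all zero, of absolute value at most `#Unk · (D + nL)^S (mM+1)^D`, such that
`Q_{l,t} = 0` identically for all `l ∈ [0,M)^m` and `t < S` (Baker 1975, Ch. 2, Lemma 1, as
`Baker1975.lemma1`). [cite: BakerTNT1975, Ch. 2 Lemma 1 (Siegel's lemma)] -/
theorem exists_coeffs (hD : 1 ≤ D) (hM : 1 ≤ M) (hS : 1 ≤ S)
    (hC1 : 2 * (M ^ m * (S * (b + (S + D + n * m * L * M)) ^ Fintype.card (Var n m))) ≤
      D * L ^ n * b ^ Fintype.card (Var n m)) :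
    ∃ p : Unk n m D L b → ℤ, p ≠ 0 ∧
      (∀ w, |(p w : ℝ)| ≤ (Fintype.card (Unk n m D L b) : ℝ) *
        (((D : ℝ) + n * L) ^ S * ((m : ℝ) * M + 1) ^ D)) ∧
      ∀ l : Fin m → ℕ, (∀ j, l j < M) → ∀ t < S, Q p l t = 0 := by
  set NE := Fintype.card (EqIdx n m D L M S b) with hNE
  set NU := Fintype.card (Unk n m D L b) with hNU
  have h2 : 2 * NE ≤ NU := by rw [hNE, hNU, card_EqIdx, card_Unk]; exact hC1
  have hNEpos : 0 < NE := by
    rw [hNE, card_EqIdx]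
    have : 0 < b + (S + D + n * m * L * M) := by omega
    positivity
  have hlt : NE < NU := by omega
  set eE := Fintype.equivFin (EqIdx n m D L M S b)
  set eU := Fintype.equivFin (Unk n m D L b)
  set U : ℝ := ((D : ℝ) + n * L) ^ S * ((m : ℝ) * M + 1) ^ D with hU
  have hU1 : 1 ≤ U := by
    have h1 : (1 : ℝ) ≤ (D : ℝ) + n * L := by
      have : (1 : ℝ) ≤ D := by exact_mod_cast hD
      have : (0 : ℝ) ≤ n * L := by positivity
      linarith
    have h2 : (1 : ℝ) ≤ (m : ℝ) * M + 1 := le_add_of_nonneg_left (by positivity)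
    exact one_le_mul_of_one_le_of_one_le (one_le_pow₀ h1) (one_le_pow₀ h2)
  obtain ⟨xv, hx0, hxb, hxe⟩ := Literature.NumberTheory.Transcendental.Baker1975.lemma1 hNEpos hlt
    hU1 (fun i j => mat (eE.symm i) (eU.symm j)) (fun i j => abs_mat_le _ _)
  refine ⟨fun w => xv (eU w), ?_, ?_, ?_⟩
  · intro h0
    apply hx0
    funext j
    have := congrFun h0 (eU.symm j)
    simpa using this
  · intro w
    refine (hxb (eU w)).trans ?_
    have hbase : (1 : ℝ) ≤ NU * U := by
      have : (1 : ℝ) ≤ NU := by exact_mod_cast (show 1 ≤ NU by omega)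
      nlinarith
    have hexp1 : (NE : ℝ) / (NU - NE) ≤ 1 := by
      rw [div_le_one]
      · have : ((2 * NE : ℕ) : ℝ) ≤ NU := by exact_mod_cast h2
        push_cast at this
        linarith
      · have : ((NE : ℕ) : ℝ) < NU := by exact_mod_cast hlt
        linarith
    calc ((NU : ℝ) * U) ^ ((NE : ℝ) / (NU - NE)) ≤ ((NU : ℝ) * U) ^ (1 : ℝ) :=
          Real.rpow_le_rpow_of_exponent_le hbase hexp1
      _ = NU * U := Real.rpow_one _
  · intro l hl t ht
    ext e
    rw [MvPolynomial.coeff_zero]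
    by_cases hsmall : ∀ v, e v < b + (S + D + n * m * L * M)
    · -- an equation of the system
      set l' : Fin m → Fin M := fun j => ⟨l j, hl j⟩
      set t' : Fin S := ⟨t, ht⟩
      set e' : ExpIdxE n m b (S + D + n * m * L * M) := fun v => ⟨e v, hsmall v⟩
      have hee : e = toExpE e' := by ext v; rfl
      have hll : l = natOf l' := rfl
      rw [coeff_Q, hee, hll]
      have := hxe (eE (l', t', e'))
      simp only [Equiv.symm_apply_apply] at this
      rw [← Equiv.sum_comp eU.symm (fun w : Unk n m D L b =>
        xv (eU w) * coeff (toExpE e') (monomial (toExp w.2) 1 *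
          Vsym t (natOf l') (w.1.1 : ℕ) (natOf w.1.2)))]
      rw [← this]
      refine Finset.sum_congr rfl fun j _ => ?_
      simp only [Equiv.apply_symm_apply, mat]
      ring
    · -- not a monomial of `Q_{l,t}`
      have hnot : e ∉ (Q (fun w => xv (eU w)) l t).support := fun he =>
        hsmall (lt_of_mem_support_Q _ hl ht he)
      exact MvPolynomial.notMem_support_iff.mp hnot

/-! ### The derived polynomials `P_{aμj} = (1/j!)∂^j P_{aμ}` and `Q_{l,t,j}` (Diaz's device) -/

/-- `P_{aμj} = taylorCoeff j P_{aμ} ∈ ℤ[Var]` (the integer Taylor coefficient, i.e.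
`(1/j!) ∂^j P_{aμ}`; Diaz 1989, §II-3-1). [cite: Diaz1989, §II-3-1 p. 6] -/
def Pj (p : Unk n m D L b → ℤ) (am : AM n D L) (j : Var n m →₀ ℕ) : MvPolynomial (Var n m) ℤ :=
  taylorCoeff j (Pam p am)

/-- `Q_{l,t,j} = ∑_{a,μ} P_{aμj} V_{t,l,a,μ}` — the members of the family fed to Philippon's
criterion. [cite: Diaz1989, §II-3-1 p. 6 (the polynomials Q_{μj}, here with derivatives)] -/
def Qj (p : Unk n m D L b → ℤ) (l : Fin m → ℕ) (t : ℕ) (j : Var n m →₀ ℕ) :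
    MvPolynomial (Var n m) ℤ :=
  ∑ am : AM n D L, Pj p am j * Vsym t l (am.1 : ℕ) (natOf am.2)

/-- `j = 0` gives back `P_{aμ}`. [folklore] -/
theorem Pj_zero (p : Unk n m D L b → ℤ) (am : AM n D L) : Pj p am 0 = Pam p am := by
  classical
  unfold Pj
  exact taylorCoeff_zero_index _

/-- **Minimal index at a point** `θ'` (Diaz 1989, §II-3-1): some `P_{aμj}(θ') ≠ 0` while all
`P_{aμj'}(θ') = 0` for `|j'| < |j|`. [cite: Diaz1989, §II-3-1 p. 6] -/
def IsMinIdx (p : Unk n m D L b → ℤ) (θ' : Var n m → ℂ) (j : Var n m →₀ ℕ) : Prop :=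
  (∃ am, aeval θ' (Pj p am j) ≠ 0) ∧ ∀ am j', degree j' < degree j → aeval θ' (Pj p am j') = 0

/-- **Existence of a minimal index at every point**, as soon as `p ≠ 0`.
[cite: Diaz1989, §II-3-1 p. 6] -/
theorem exists_isMinIdx {p : Unk n m D L b → ℤ} (hp : p ≠ 0) (θ' : Var n m → ℂ) :
    ∃ j, IsMinIdx p θ' j := by
  classical
  obtain ⟨a₀, ha₀⟩ : ∃ am, Pam p am ≠ 0 := by
    by_contra h
    push Not at h
    exact hp (eq_zero_of_Pam_eq_zero h)
  have hex : ∃ N : ℕ, ∃ am j, degree j = N ∧ aeval θ' (Pj p am j) ≠ 0 := by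
    by_contra h
    push Not at h
    apply ha₀
    refine eq_zero_of_forall_eval₂_taylorCoeff (f := algebraMap ℤ ℂ)
      (RingHom.injective_int (algebraMap ℤ ℂ)) θ' fun j => ?_
    have := h (degree j) a₀ j rfl
    simpa [Pj, MvPolynomial.aeval_def] using this
  obtain ⟨am, j, hj, hne⟩ := Nat.find_spec hex
  refine ⟨j, ⟨am, hne⟩, fun am' j' hlt => ?_⟩
  by_contra hne'
  have : Nat.find hex ≤ degree j' := Nat.find_min' hex ⟨am', j', rfl, hne'⟩
  rw [hj] at hlt
  omega

/-- A minimal index has length at most the common degree bound of the `P_{aμ}`: if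
`deg P_{aμ} ≤ T` for all `(a, μ)` then `|j| ≤ T`. [folklore] -/
theorem degree_le_of_isMinIdx {p : Unk n m D L b → ℤ} {θ' : Var n m → ℂ} {j : Var n m →₀ ℕ}
    (hj : IsMinIdx p θ' j) {T : ℕ} (hT : ∀ am, (Pam p am).totalDegree ≤ T) : degree j ≤ T := by
  classical
  obtain ⟨am, ham⟩ := hj.1
  by_contra hlt
  apply ham
  have : Pj p am j = 0 := taylorCoeff_eq_zero_of_lt j (Pam p am) (by have := hT am; omega)
  rw [this, map_zero]

/-- **The key identity** (Diaz 1989, p. 9, with derivatives): if `Q_{l,t} = 0` identically and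
`j` is a minimal index at `θ'`, then `Q_{l,t,j}(θ') = 0` — EXACTLY, at the perturbed point.
[cite: Diaz1989, §II-3-2 (b) p. 9] -/
theorem aeval_Qj_eq_zero_of_isMinIdx {p : Unk n m D L b → ℤ} {l : Fin m → ℕ} {t : ℕ}
    (hQ : Q p l t = 0) {θ' : Var n m → ℂ} {j : Var n m →₀ ℕ} (hj : IsMinIdx p θ' j) :
    aeval θ' (Qj p l t j) = 0 := by
  classical
  have := sum_eval_taylorCoeff_mul_eq_zero (algebraMap ℤ ℂ) θ' Finset.univ (Pam p)
    (fun am => Vsym t l (am.1 : ℕ) (natOf am.2)) (by simpa [Q] using hQ) j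
    (fun am _ j' hj' => by
      have := hj.2 am j' hj'
      simpa [Pj, MvPolynomial.aeval_def] using this)
  simpa [Qj, Pj, MvPolynomial.aeval_def, map_sum, map_mul] using this

/-- **`Q_{l,t,j}` at an arbitrary point `θ'` is a `t`-th derivative at `0`**, as for `Q_{l,t}`
(`aeval_Q_eq_iteratedDeriv`) with `P_{aμj}` in place of `P_{aμ}`. [folklore] -/
theorem aeval_Qj_eq_iteratedDeriv (θ' : Var n m → ℂ) (p : Unk n m D L b → ℤ) (l : Fin m → ℕ)
    (t : ℕ) (j : Var n m →₀ ℕ) :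
    aeval θ' (Qj p l t j) =
      iteratedDeriv t (fun τ : ℂ => ∑ am : AM n D L,
        aeval θ' (Pj p am j) * aeval θ' (Esym (natOf am.2) l) *
          ((aeval θ' (Ysym n l) + τ) ^ (am.1 : ℕ) * cexp (aeval θ' (Wsym m (natOf am.2)) * τ))) 0 := by
  unfold Qj
  rw [map_sum, iteratedDeriv_fun_sum fun am _ => by fun_prop]
  refine Finset.sum_congr rfl fun am _ => ?_
  rw [map_mul, aeval_Vsym_eq']

/-! ### Sizes: degrees and lengths -/

/-- `deg P_{aμ} ≤ (b - 1) · #Var`. [folklore] -/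
theorem totalDegree_Pam_le (p : Unk n m D L b → ℤ) (am : AM n D L) :
    (Pam p am).totalDegree ≤ (b - 1) * Fintype.card (Var n m) := by
  classical
  unfold Pam
  refine totalDegree_finsetSum_le fun ε _ => (totalDegree_monomial_le _ _).trans ?_
  rw [Finsupp.sum_fintype _ _ (fun _ => rfl)]
  calc ∑ v, (toExp ε v) ≤ ∑ _v : Var n m, (b - 1) :=
        Finset.sum_le_sum fun v _ => by rw [toExp_apply]; have := (ε v).isLt; omega
    _ = (b - 1) * Fintype.card (Var n m) := by simp [mul_comm]

/-- `deg P_{aμj} ≤ (b - 1) · #Var`. [cite: Diaz1989, §II-3-2 (2) p. 8] -/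
theorem totalDegree_Pj_le (p : Unk n m D L b → ℤ) (am : AM n D L) (j : Var n m →₀ ℕ) :
    (Pj p am j).totalDegree ≤ (b - 1) * Fintype.card (Var n m) := by
  classical
  exact (totalDegree_taylorCoeff_le j (Pam p am)).trans (totalDegree_Pam_le p am)

/-- `L(P_{aμ}) ≤ #ExpIdx · H` when all unknowns are `≤ H` in absolute value. [folklore] -/
theorem l1_Pam_le (p : Unk n m D L b → ℤ) {H : ℝ} (hH : ∀ w, |(p w : ℝ)| ≤ H) (am : AM n D L) :
    l1 (Pam p am) ≤ Fintype.card (ExpIdx n m b) * H := by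
  unfold Pam
  refine (wnorm_sum_le _ _ _).trans ?_
  calc ∑ ε : ExpIdx n m b, wnorm (normRingSeminorm ℤ) (monomial (toExp ε) (p (am, ε)))
      ≤ ∑ _ε : ExpIdx n m b, H := Finset.sum_le_sum fun ε _ => by
        rw [Chudnovsky.wnorm_monomial, Chudnovsky.normRingSeminorm_int_apply]; exact hH (am, ε)
    _ = Fintype.card (ExpIdx n m b) * H := by simp

/-- **`L(P_{aμj}) ≤ 2^{(b-1)#Var} · #ExpIdx · H`.** [cite: Diaz1989, §II-3-2 (3) p. 8] -/
theorem l1_Pj_le (p : Unk n m D L b → ℤ) {H : ℝ} (hH : ∀ w, |(p w : ℝ)| ≤ H) (am : AM n D L)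
    (j : Var n m →₀ ℕ) :
    l1 (Pj p am j) ≤ 2 ^ ((b - 1) * Fintype.card (Var n m)) * (Fintype.card (ExpIdx n m b) * H) := by
  classical
  unfold Pj
  refine (l1_taylorCoeff_le j (Pam p am)).trans ?_
  exact mul_le_mul (pow_le_pow_right₀ (by norm_num) (totalDegree_Pam_le p am))
    (l1_Pam_le p hH am) (wnorm_nonneg _ _) (by positivity)

/-- **`deg Q_{l,t,j} ≤ (b-1)#Var + t + D + nmLM'`** for `l ∈ [0, M')^m`.
[cite: Diaz1989, §II-3-3 (8) p. 11] -/
theorem totalDegree_Qj_le (p : Unk n m D L b → ℤ) {M' : ℕ} {l : Fin m → ℕ} (hl : ∀ j, l j < M')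
    (t : ℕ) (j : Var n m →₀ ℕ) :
    (Qj p l t j).totalDegree ≤ (b - 1) * Fintype.card (Var n m) + (t + D + n * m * L * M') := by
  classical
  unfold Qj
  refine totalDegree_finsetSum_le fun am _ => (totalDegree_mul _ _).trans ?_
  refine Nat.add_le_add (totalDegree_Pj_le p am j) ?_
  refine (totalDegree_Vsym_le t l (am.1 : ℕ) (natOf am.2)).trans ?_
  have h3 : ∑ i, ∑ j', natOf am.2 i * l j' ≤ n * m * L * M' := by
    calc ∑ i, ∑ j', natOf am.2 i * l j' ≤ ∑ _i : Fin n, ∑ _j : Fin m, L * M' :=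
          Finset.sum_le_sum fun i _ => Finset.sum_le_sum fun j' _ =>
            Nat.mul_le_mul (natOf_lt am.2 i).le (hl j').le
      _ = n * m * L * M' := by simp [mul_comm, mul_left_comm]
  have h4 : (am.1 : ℕ) < D := am.1.isLt
  omega

/-- **`L(Q_{l,t,j}) ≤ #AM · 2^{(b-1)#Var} #ExpIdx H · (D + nL)^t (mM' + 1)^D`** for
`l ∈ [0, M')^m`. [cite: Diaz1989, §II-3-3 (8), (9) p. 11] -/
theorem l1_Qj_le (p : Unk n m D L b → ℤ) {H : ℝ} (hH : ∀ w, |(p w : ℝ)| ≤ H)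
    {M' : ℕ} {l : Fin m → ℕ} (hl : ∀ j, l j < M') (t : ℕ) (j : Var n m →₀ ℕ) :
    l1 (Qj p l t j) ≤ Fintype.card (AM n D L) *
      ((2 ^ ((b - 1) * Fintype.card (Var n m)) * (Fintype.card (ExpIdx n m b) * H)) *
        (((D : ℝ) + n * L) ^ t * ((m : ℝ) * M' + 1) ^ D)) := by
  classical
  unfold Qj
  refine (wnorm_sum_le _ _ _).trans ?_
  have hterm : ∀ am : AM n D L, wnorm (normRingSeminorm ℤ) (Pj p am j * Vsym t l (am.1 : ℕ) (natOf am.2)) ≤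
      (2 ^ ((b - 1) * Fintype.card (Var n m)) * (Fintype.card (ExpIdx n m b) * H)) *
        (((D : ℝ) + n * L) ^ t * ((m : ℝ) * M' + 1) ^ D) := by
    intro am
    refine (wnorm_mul_le _ _ _).trans ?_
    have hV := l1_Vsym_le t (m := M') (L₁ := L) l hl (am.1 : ℕ) (natOf am.2) (natOf_lt am.2)
    have hV' : l1 (Vsym t l (am.1 : ℕ) (natOf am.2)) ≤ ((D : ℝ) + n * L) ^ t * ((m : ℝ) * M' + 1) ^ D := by
      refine hV.trans ?_
      have h2 : (1 : ℝ) ≤ (m : ℝ) * M' + 1 := le_add_of_nonneg_left (by positivity)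
      have ha : (((am.1 : ℕ) : ℝ) + n * L) ≤ (D : ℝ) + n * L := by
        have : (((am.1 : ℕ) : ℝ)) ≤ D := by exact_mod_cast am.1.isLt.le
        linarith
      calc ((((am.1 : ℕ) : ℝ) + n * L) ^ t * ((m : ℝ) * M' + 1) ^ (am.1 : ℕ))
          ≤ ((D : ℝ) + n * L) ^ t * ((m : ℝ) * M' + 1) ^ (am.1 : ℕ) := by gcongr
        _ ≤ ((D : ℝ) + n * L) ^ t * ((m : ℝ) * M' + 1) ^ D := by
            gcongr
            · exact am.1.isLt.le
    have hP0 : 0 ≤ (2 : ℝ) ^ ((b - 1) * Fintype.card (Var n m)) * (Fintype.card (ExpIdx n m b) * H) :=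
      (wnorm_nonneg (normRingSeminorm ℤ) (Pj p am j)).trans (l1_Pj_le p hH am j)
    exact mul_le_mul (l1_Pj_le p hH am j) hV' (wnorm_nonneg _ _) hP0
  calc ∑ am : AM n D L, wnorm (normRingSeminorm ℤ) (Pj p am j * Vsym t l (am.1 : ℕ) (natOf am.2))
      ≤ ∑ _am : AM n D L, (2 ^ ((b - 1) * Fintype.card (Var n m)) * (Fintype.card (ExpIdx n m b) * H)) *
        (((D : ℝ) + n * L) ^ t * ((m : ℝ) * M' + 1) ^ D) := Finset.sum_le_sum fun am _ => hterm am
    _ = _ := by simp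

end DiazMainIII

end Literature.NumberTheory.Transcendental

end
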